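import Summits.AtomisticToContinuum.Crystallization.Theorems.ChartedZeroExcessLayeredHomCoercivityBD
import Summits.AtomisticToContinuum.Crystallization.Theorems.LayeredLawsSelectHcp.Negative.IntegerForms
import Literature.Algebra.EuclideanLattices.FccBccLattices

/-!
# ChartedZeroExcessLayered · HomCoercivityBD — part B/3: §5–§5.3 (non-vacuity kernels: integer-model helpers, the fcc lattice, the bounded-distortion chart) (decomp-a2c lens-2 g24 `HomCoercivityBD.lean` v8 sha256 e49c2223…, lines 326–644,
split at the `## §` boundaries for the gate's 400-line limit; ONE namespace `…Theorems.ChartedZeroExcessLayeredHomCoercivityBD` across the parts, linear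
import chain; critic rows 444/445).  v9 (lens-2 g25, hand-2 g9 dry-run list INBOX l.521): REBASED on the tree twins — the eight §5.1 «mirrors of
IntegerForms» are DELETED and their uses re-pointed: `even_sqNormInt` / `two_le_sqNormInt` / `mem_fccInt_of_sqNormInt`
(`…LayeredLawsSelectHcp.Negative.IntegerForms`, imported), `intVec_sub` (`Literature.Geometry.DiscreteGeometry`, KissingPatterns), `norm_sq_fin_three`
(`Literature.Algebra.EuclideanLattices.FccBccLattices`, imported) are CITED; `sqNormInt_nonneg` is inlined; `intVec_zero'` is replaced by the form actually
used, `kk_smul_intVec_zero`; the second-shell twin `…PhononSlackCertificatesNearFarGlueR.mem_fccSecondShellInt_of_sqNormInt` lives in module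
`…NearFarGlueRLatticeShell`, UNIMPORTABLE on the farm at writing (its import `…LayeredLawsSelectHcp.Negative.FccLattice` is unbuilt: `lean check` rc 75
`remote:stale:unbuilt`, 2026-08-31T12:2xZ, twice) — so the ONE place that needs it uses the COMBINED two-shell classification `mem_twoShellInt_of_sqNormInt`
(hypothesis `sqNormInt v = 2 ∨ sqNormInt v = 4`, conclusion `v ∈ fccInt ∪ fccSecondShellInt`; first shell by the cited IntegerForms lemma, second shell by
the bounded case split).  Every other declaration is byte-identical to v8 lines 326–644 (docstrings added by hand-2 g9).
-/

noncomputable section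

open scoped BigOperators
open MeasureTheory Set Metric
open Summit.AtomisticToContinuum.Crystallization.Theorems.ChartedPlanarOrderRigidityDoor
open Summit.AtomisticToContinuum.Crystallization.Theorems.ChartedPlanarOrderDensityDichotomy
open Summit.AtomisticToContinuum.Crystallization.Theorems.ChartedPlanarOrderMesoCut
open Summit.AtomisticToContinuum.Crystallization.Theorems.OverbindingBudgetLiouvilleDictionary
open Literature.MathematicalPhysics.StatisticalMechanics (triangularVec₁ triangularVec₂)
open Literature.Geometry.DiscreteGeometry
open Summit.AtomisticToContinuum.Crystallization.Theorems.LayeredLawsSelectHcp.Negative.IntegerForms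
  (even_sqNormInt two_le_sqNormInt mem_fccInt_of_sqNormInt)
open Literature.Algebra.EuclideanLattices (norm_sq_fin_three)
open Summit.AtomisticToContinuum.Crystallization.Theorems.ChartedPlanarOrderDoorLayered
  (IsPeriod TwoPeriodic twoPeriodic_layeredHom_of_BD nearHomBD_restrict isCleanChunk_window' atomsIn_subset
   DoorHomogeneityBD NearHomBulkGapDenseBD hbgBD_of_bulk bulkDoor_of_homBD gap_and_pert_1_50_of_homBD
   DoorPeriodic PeriodicBulkGap PeriodicBulkGapDoor periodicBulkGap_of_bulk periodicBulkGapDoor_of_periodicBulkGap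
   bulkDoor_of_periodic gap_and_pert_1_50_of_periodic' doorPeriodic_of_doorHomogeneityBD hbg_pieces_both_of_bulk)
open Summit.AtomisticToContinuum.Crystallization.Theorems.ChartedPlanarOrderDoorLayeredBridge (layeredHom_of_twoPeriodic)

namespace Summit.AtomisticToContinuum.Crystallization.Theorems.ChartedZeroExcessLayeredHomCoercivityBD

/-! ## §5  NON-VACUITY KERNELS (rule NV): (w1) the isolated atom, (w2) the scale-incoherent two-patch -/

/-- **(w1)** an isolated atom is not `(2, τ, r)`-near-homogeneous for `r ≥ 2`, `τ < 1/2` (instance of lens-4's tree lemma at `Λ₀ = 2`). -/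
theorem not_nearHomBD_isolated {τ r : ℝ} (hr : 2 ≤ r) (hτ : τ < 1 / 2) (x : E3) : ¬ NearHomBD 2 τ r {x} {x} :=
  not_nearHomBD_singleton hr (by linarith) x

/-! ### §5.1 integer-model helpers (v9: the integer-form lemmas are the TREE's `…LayeredLawsSelectHcp.Negative.IntegerForms`, cited by name) -/

/-- `1/√2 = √2/2`, the cubic scale of the fcc lattice at nearest-neighbour distance `1`. -/
def kk : ℝ := Real.sqrt 2 / 2

/-- Helper `kk_pos` (lens-2 g24 HomCoercivityBD v8 §5.1–§5.3; statement as displayed). [folklore] -/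
theorem kk_pos : 0 < kk := by unfold kk; positivity

/-- Helper `kk_sq` (lens-2 g24 HomCoercivityBD v8 §5.1–§5.3; statement as displayed). [folklore] -/
theorem kk_sq : kk ^ 2 = 1 / 2 := by
  rw [kk, div_pow, Real.sq_sqrt (by norm_num)]; norm_num

/-- Helper `kk_mul_sqrt_two` (lens-2 g24 HomCoercivityBD v8 §5.1–§5.3; statement as displayed). [folklore] -/
theorem kk_mul_sqrt_two : kk * Real.sqrt 2 = 1 := by
  have h : Real.sqrt 2 * Real.sqrt 2 = 2 := Real.mul_self_sqrt (by norm_num)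
  rw [kk]; linarith [h]

/-- Helper `seven_tenths_le_kk` (lens-2 g24 HomCoercivityBD v8 §5.1–§5.3; statement as displayed). [folklore] -/
theorem seven_tenths_le_kk : 7 / 10 ≤ kk := by
  have h : Real.sqrt 2 ^ 2 = 2 := Real.sq_sqrt (by norm_num)
  have h0 : 0 ≤ Real.sqrt 2 := Real.sqrt_nonneg 2
  rw [kk]
  nlinarith

/-- Helper `kk_le_one` (lens-2 g24 HomCoercivityBD v8 §5.1–§5.3; statement as displayed). [folklore] -/
theorem kk_le_one : kk ≤ 1 := by
  have h : Real.sqrt 2 ^ 2 = 2 := Real.sq_sqrt (by norm_num)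
  have h0 : 0 ≤ Real.sqrt 2 := Real.sqrt_nonneg 2
  rw [kk]
  nlinarith

/-- Helper `inv_sqrt_two_eq_kk` (lens-2 g24 HomCoercivityBD v8 §5.1–§5.3; statement as displayed). [folklore] -/
theorem inv_sqrt_two_eq_kk : (Real.sqrt ((2 : ℕ) : ℝ))⁻¹ = kk := by
  rw [Nat.cast_ofNat, kk, eq_div_iff two_ne_zero]
  have h : Real.sqrt 2 * Real.sqrt 2 = 2 := Real.mul_self_sqrt (by norm_num)
  have h0 : Real.sqrt 2 ≠ 0 := by positivity
  field_simp
  linarith [h]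

/-- Helper `even_of_mem_twoShellInt` (lens-2 g24 HomCoercivityBD v8 §5.1–§5.3; statement as displayed). [folklore] -/
theorem even_of_mem_twoShellInt : ∀ v ∈ fccInt ∪ fccSecondShellInt, Even (v 0 + v 1 + v 2) := by decide

/-- Helper `norm_kk_smul_intVec` (lens-2 g24 HomCoercivityBD v8 §5.1–§5.3; statement as displayed). [folklore] -/
theorem norm_kk_smul_intVec (v : Fin 3 → ℤ) : ‖kk • intVec v‖ = kk * Real.sqrt (sqNormInt v : ℝ) := by
  rw [norm_smul, Real.norm_of_nonneg kk_pos.le, norm_intVec]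

/-- **the two-shell classification of even integer vectors of square norm `2` or `4`**: they are the `12 + 6` vectors of `fccInt ∪ fccSecondShellInt`
(first shell: the tree's `IntegerForms.mem_fccInt_of_sqNormInt`; second shell: coordinates are bounded by `2`, then a finite case split — the tree's
`…PhononSlackCertificatesNearFarGlueR.mem_fccSecondShellInt_of_sqNormInt` states that half but its module is not importable on the farm at writing). [folklore] -/
theorem mem_twoShellInt_of_sqNormInt {v : Fin 3 → ℤ} (h : sqNormInt v = 2 ∨ sqNormInt v = 4) : v ∈ fccInt ∪ fccSecondShellInt := by
  rcases h with h | h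
  · exact Finset.mem_union_left _ (mem_fccInt_of_sqNormInt h)
  · refine Finset.mem_union_right _ ?_
    have hv : v = ![v 0, v 1, v 2] := by
      funext l; fin_cases l <;> rfl
    set p := v 0 with hp
    set q := v 1 with hq
    set r := v 2 with hr
    rw [hv] at h ⊢
    simp only [sqNormInt, Matrix.cons_val_zero, Matrix.cons_val_one, Matrix.cons_val_two,
      Matrix.tail_cons, Matrix.head_cons] at h
    have hp2 : p ^ 2 ≤ 4 := by nlinarith [sq_nonneg q, sq_nonneg r]
    have hq2 : q ^ 2 ≤ 4 := by nlinarith [sq_nonneg p, sq_nonneg r]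
    have hr2 : r ^ 2 ≤ 4 := by nlinarith [sq_nonneg p, sq_nonneg q]
    have hp1 : -2 ≤ p ∧ p ≤ 2 := by constructor <;> nlinarith
    have hq1 : -2 ≤ q ∧ q ≤ 2 := by constructor <;> nlinarith
    have hr1 : -2 ≤ r ∧ r ≤ 2 := by constructor <;> nlinarith
    obtain ⟨hp1, hp1'⟩ := hp1
    obtain ⟨hq1, hq1'⟩ := hq1
    obtain ⟨hr1, hr1'⟩ := hr1
    clear_value p q r
    interval_cases p <;> interval_cases q <;> interval_cases r <;> first | decide | (norm_num at h)

/-- `kk • intVec 0 = 0` (the form in which the integer origin enters §5.2). [folklore] -/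
theorem kk_smul_intVec_zero : kk • intVec (0 : Fin 3 → ℤ) = (0 : E3) := by
  have h : intVec (0 : Fin 3 → ℤ) = 0 := by ext i; simp [intVec]
  rw [h, smul_zero]

/-! ### §5.2 the fcc lattice at nearest-neighbour distance `1` in cubic coordinates, `(1/√2)·D₃` -/

/-- the fcc lattice `(1/√2)·D₃` (integer vectors of even coordinate sum, scaled to nearest-neighbour distance `1`). -/
def fcc : Set E3 := {z | ∃ v : Fin 3 → ℤ, Even (v 0 + v 1 + v 2) ∧ z = kk • intVec v}

/-- Helper `zero_mem_fcc` (lens-2 g24 HomCoercivityBD v8 §5.1–§5.3; statement as displayed). [folklore] -/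
theorem zero_mem_fcc : (0 : E3) ∈ fcc := ⟨0, by simp, by rw [kk_smul_intVec_zero]⟩

/-- Helper `sub_mem_fcc` (lens-2 g24 HomCoercivityBD v8 §5.1–§5.3; statement as displayed). [folklore] -/
theorem sub_mem_fcc {x y : E3} (hx : x ∈ fcc) (hy : y ∈ fcc) : x - y ∈ fcc := by
  obtain ⟨v, hv, rfl⟩ := hx
  obtain ⟨w, hw, rfl⟩ := hy
  refine ⟨v - w, ?_, by rw [← smul_sub, intVec_sub]⟩
  have : (v - w) 0 + (v - w) 1 + (v - w) 2 = (v 0 + v 1 + v 2) - (w 0 + w 1 + w 2) := by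
    simp only [Pi.sub_apply]; ring
  rw [this]; exact hv.sub hw

/-- non-zero fcc vectors have norm `≥ 1`. -/
theorem one_le_norm_of_mem_fcc {z : E3} (hz : z ∈ fcc) (hne : z ≠ 0) : 1 ≤ ‖z‖ := by
  obtain ⟨v, hv, rfl⟩ := hz
  have hv0 : v ≠ 0 := by rintro rfl; exact hne (by rw [kk_smul_intVec_zero])
  have h2 : (2 : ℝ) ≤ sqNormInt v := by exact_mod_cast two_le_sqNormInt hv0 hv
  rw [norm_kk_smul_intVec]
  calc (1 : ℝ) = kk * Real.sqrt 2 := kk_mul_sqrt_two.symm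
    _ ≤ kk * Real.sqrt (sqNormInt v : ℝ) := mul_le_mul_of_nonneg_left (Real.sqrt_le_sqrt h2) kk_pos.le

/-- `fcc` is `1`-separated. -/
theorem one_le_dist_of_mem_fcc {x y : E3} (hx : x ∈ fcc) (hy : y ∈ fcc) (hne : x ≠ y) : 1 ≤ dist x y := by
  rw [dist_eq_norm]; exact one_le_norm_of_mem_fcc (sub_mem_fcc hx hy) (sub_ne_zero.2 hne)

/-- the two-shell pattern lies in `fcc`. -/
theorem mem_fcc_of_mem_pattern {v : E3} (hv : v ∈ (fccTwoShellPattern : Finset E3)) : v ∈ fcc := by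
  rw [fccTwoShellPattern, scaledPattern, Finset.mem_image] at hv
  obtain ⟨u, hu, rfl⟩ := hv
  exact ⟨u, even_of_mem_twoShellInt u hu, by rw [inv_sqrt_two_eq_kk]⟩

/-- pattern points have norm `≤ 3/2`. -/
theorem norm_le_of_mem_pattern {v : E3} (hv : v ∈ (fccTwoShellPattern : Finset E3)) : ‖v‖ ≤ 3 / 2 := by
  rw [fccTwoShellPattern, scaledPattern, Finset.mem_image] at hv
  obtain ⟨u, hu, rfl⟩ := hv
  rw [inv_sqrt_two_eq_kk, norm_kk_smul_intVec]
  have h4 : (sqNormInt u : ℝ) ≤ 4 := by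
    rcases sqNormInt_fccTwoShellInt u hu with h | h <;> · rw [h]; norm_num
  have hs : Real.sqrt (sqNormInt u : ℝ) ≤ 2 := by
    rw [show (2 : ℝ) = Real.sqrt (2 ^ 2) by rw [Real.sqrt_sq (by norm_num)]]
    exact Real.sqrt_le_sqrt (by linarith)
  nlinarith [kk_le_one, kk_pos, Real.sqrt_nonneg (sqNormInt u : ℝ), seven_tenths_le_kk, kk_sq]

/-- **the `3/2`-shell of the origin in `fcc` is the two-shell pattern.** -/
theorem mem_pattern_of_mem_fcc {z : E3} (hz : z ∈ fcc) (hne : z ≠ 0) (hle : ‖z‖ ≤ 3 / 2) :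
    z ∈ (fccTwoShellPattern : Finset E3) := by
  obtain ⟨v, hv, rfl⟩ := hz
  have hv0 : v ≠ 0 := by rintro rfl; exact hne (by rw [kk_smul_intVec_zero])
  have h2 := two_le_sqNormInt hv0 hv
  rw [norm_kk_smul_intVec] at hle
  have hs0 : (0 : ℝ) ≤ sqNormInt v := by
    have h0 : (0 : ℤ) ≤ sqNormInt v := by unfold sqNormInt; positivity
    exact_mod_cast h0
  have h4 : (kk * Real.sqrt (sqNormInt v)) ^ 2 ≤ (3 / 2) ^ 2 :=
    pow_le_pow_left₀ (mul_nonneg kk_pos.le (Real.sqrt_nonneg _)) hle 2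
  rw [mul_pow, Real.sq_sqrt hs0, kk_sq] at h4
  have h5 : (sqNormInt v : ℝ) < 5 := by nlinarith
  have h6 : sqNormInt v < 5 := by exact_mod_cast h5
  rcases even_sqNormInt hv with ⟨m, hm⟩
  have hs : sqNormInt v = 2 ∨ sqNormInt v = 4 := by omega
  have hmem : v ∈ fccInt ∪ fccSecondShellInt := mem_twoShellInt_of_sqNormInt hs
  rw [fccTwoShellPattern, scaledPattern, Finset.mem_image]
  exact ⟨v, hmem, by rw [inv_sqrt_two_eq_kk]⟩

/-! ### §5.3 a bounded-distortion chart carrying the triangular layers onto the `(001)` square layers of `fcc` -/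

/-- `√3`. -/
def ss : ℝ := Real.sqrt 3

/-- Helper `ss_sq` (lens-2 g24 HomCoercivityBD v8 §5.1–§5.3; statement as displayed). [folklore] -/
theorem ss_sq : ss ^ 2 = 3 := by rw [ss, Real.sq_sqrt (by norm_num)]

/-- the `(001)` shear chart `(x, y, z) ↦ ((x + y/√3)/√2, (x − √3 y)/√2, z)`: it maps the unit triangular lattice `ℤt₁ ⊕ ℤt₂` onto the
square lattice `(1/√2)·{(a, b, 0) : a + b even}` (a `(001)` layer of `fcc`); singular values `√2, √(2/3), 1` — distortion `< 2`. -/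
def chartLin : E3 →ₗ[ℝ] E3 where
  toFun v := !₂[kk * (v 0 + ss / 3 * v 1), kk * (v 0 - ss * v 1), v 2]
  map_add' v w := by
    ext i; fin_cases i <;> simp <;> ring
  map_smul' c v := by
    ext i; fin_cases i <;> simp <;> ring

/-- Helper `chartLin_apply` (lens-2 g24 HomCoercivityBD v8 §5.1–§5.3; statement as displayed). [folklore] -/
theorem chartLin_apply (v : E3) : chartLin v = !₂[kk * (v 0 + ss / 3 * v 1), kk * (v 0 - ss * v 1), v 2] := rfl

/-- Helper `normsq_chartLin` (lens-2 g24 HomCoercivityBD v8 §5.1–§5.3; statement as displayed). [folklore] -/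
theorem normsq_chartLin (v : E3) :
    ‖chartLin v‖ ^ 2 = v 0 ^ 2 - 2 / 3 * ss * v 0 * v 1 + 5 / 3 * v 1 ^ 2 + v 2 ^ 2 := by
  rw [norm_sq_fin_three, chartLin_apply]
  have e : (kk * (v 0 + ss / 3 * v 1)) ^ 2 + (kk * (v 0 - ss * v 1)) ^ 2 + v 2 ^ 2 =
      kk ^ 2 * (2 * v 0 ^ 2 - 4 / 3 * ss * v 0 * v 1) + kk ^ 2 * ss ^ 2 * (10 / 9 * v 1 ^ 2) + v 2 ^ 2 := by ring
  simp only [Matrix.cons_val_zero, Matrix.cons_val_one, Matrix.cons_val_two, Matrix.head_cons,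
    Matrix.tail_cons]
  rw [e, kk_sq, ss_sq]; ring

/-- `‖L v‖ ≤ 2 ‖v‖` (in fact `≤ √2 ‖v‖`). -/
theorem normsq_chartLin_le (v : E3) : ‖chartLin v‖ ^ 2 ≤ 4 * ‖v‖ ^ 2 := by
  rw [normsq_chartLin, norm_sq_fin_three]
  have hu : (ss * v 0) ^ 2 = 3 * v 0 ^ 2 := by rw [mul_pow, ss_sq]
  nlinarith [sq_nonneg (ss * v 0 / 3 + v 1), sq_nonneg (v 0), sq_nonneg (v 1), sq_nonneg (v 2)]

/-- `‖v‖² ≤ (3/2) ‖L v‖²` (the smallest singular value is `√(2/3)`). -/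
theorem le_normsq_chartLin (v : E3) : ‖v‖ ^ 2 ≤ 3 / 2 * ‖chartLin v‖ ^ 2 := by
  rw [normsq_chartLin, norm_sq_fin_three]
  have hu : (ss * v 0) ^ 2 = 3 * v 0 ^ 2 := by rw [mul_pow, ss_sq]
  nlinarith [sq_nonneg (ss * v 0 / 3 - v 1), sq_nonneg (v 0), sq_nonneg (v 1), sq_nonneg (v 2)]

/-- a linear endomorphism of `E3` with two-sided bounds `‖f v‖ ≤ 2‖v‖`, `‖v‖ ≤ 2‖f v‖` as a continuous linear automorphism. -/
def mkChart (f : E3 →ₗ[ℝ] E3) (hlow : ∀ v, ‖v‖ ≤ 2 * ‖f v‖) : E3 ≃L[ℝ] E3 :=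
  (LinearEquiv.ofInjectiveEndo f (by
    intro v w h
    have h1 : f (v - w) = 0 := by rw [map_sub, h, sub_self]
    have h2 := hlow (v - w)
    rw [h1, norm_zero, mul_zero] at h2
    exact sub_eq_zero.1 (norm_le_zero_iff.1 h2))).toContinuousLinearEquiv

/-- Helper `mkChart_apply` (lens-2 g24 HomCoercivityBD v8 §5.1–§5.3; statement as displayed). [folklore] -/
theorem mkChart_apply (f : E3 →ₗ[ℝ] E3) (hlow : ∀ v, ‖v‖ ≤ 2 * ‖f v‖) (v : E3) :
    (mkChart f hlow : E3 →L[ℝ] E3) v = f v := rfl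

/-- Helper `norm_mkChart_le` (lens-2 g24 HomCoercivityBD v8 §5.1–§5.3; statement as displayed). [folklore] -/
theorem norm_mkChart_le (f : E3 →ₗ[ℝ] E3) (hup : ∀ v, ‖f v‖ ≤ 2 * ‖v‖) (hlow : ∀ v, ‖v‖ ≤ 2 * ‖f v‖) :
    ‖(mkChart f hlow : E3 →L[ℝ] E3)‖ ≤ 2 :=
  ContinuousLinearMap.opNorm_le_bound _ (by norm_num) fun v => by rw [mkChart_apply]; exact hup v

/-- Helper `norm_mkChart_symm_le` (lens-2 g24 HomCoercivityBD v8 §5.1–§5.3; statement as displayed). [folklore] -/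
theorem norm_mkChart_symm_le (f : E3 →ₗ[ℝ] E3) (hlow : ∀ v, ‖v‖ ≤ 2 * ‖f v‖) :
    ‖((mkChart f hlow).symm : E3 →L[ℝ] E3)‖ ≤ 2 := by
  refine ContinuousLinearMap.opNorm_le_bound _ (by norm_num) fun y => ?_
  have hy : (mkChart f hlow : E3 →L[ℝ] E3) (((mkChart f hlow).symm : E3 →L[ℝ] E3) y) = y := by simp
  rw [mkChart_apply] at hy
  calc ‖((mkChart f hlow).symm : E3 →L[ℝ] E3) y‖ ≤ 2 * ‖f (((mkChart f hlow).symm : E3 →L[ℝ] E3) y)‖ := hlow _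
    _ = 2 * ‖y‖ := by rw [hy]

/-- Helper `norm_chartLin_le` (lens-2 g24 HomCoercivityBD v8 §5.1–§5.3; statement as displayed). [folklore] -/
theorem norm_chartLin_le (v : E3) : ‖chartLin v‖ ≤ 2 * ‖v‖ := by
  nlinarith [normsq_chartLin_le v, norm_nonneg (chartLin v), norm_nonneg v]

/-- Helper `le_norm_chartLin` (lens-2 g24 HomCoercivityBD v8 §5.1–§5.3; statement as displayed). [folklore] -/
theorem le_norm_chartLin (v : E3) : ‖v‖ ≤ 2 * ‖chartLin v‖ := by
  nlinarith [le_normsq_chartLin v, norm_nonneg (chartLin v), norm_nonneg v]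

/-- the scaled chart `(9/10)·L` for the second patch. -/
def chartLin' : E3 →ₗ[ℝ] E3 := (9 / 10 : ℝ) • chartLin

/-- Helper `chartLin'_apply` (lens-2 g24 HomCoercivityBD v8 §5.1–§5.3; statement as displayed). [folklore] -/
theorem chartLin'_apply (v : E3) : chartLin' v = (9 / 10 : ℝ) • chartLin v := rfl

/-- Helper `norm_chartLin'_le` (lens-2 g24 HomCoercivityBD v8 §5.1–§5.3; statement as displayed). [folklore] -/
theorem norm_chartLin'_le (v : E3) : ‖chartLin' v‖ ≤ 2 * ‖v‖ := by
  rw [chartLin'_apply, norm_smul, Real.norm_of_nonneg (by norm_num)]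
  nlinarith [norm_chartLin_le v, norm_nonneg (chartLin v)]

/-- Helper `le_norm_chartLin'` (lens-2 g24 HomCoercivityBD v8 §5.1–§5.3; statement as displayed). [folklore] -/
theorem le_norm_chartLin' (v : E3) : ‖v‖ ≤ 2 * ‖chartLin' v‖ := by
  rw [chartLin'_apply, norm_smul, Real.norm_of_nonneg (by norm_num)]
  have h := le_normsq_chartLin v
  nlinarith [norm_nonneg (chartLin v), norm_nonneg v]

/-- the chart of patch 1 (distortion `≤ 2`). -/
def chart₁ : E3 ≃L[ℝ] E3 := mkChart chartLin le_norm_chartLin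

/-- the chart of patch 2 (distortion `≤ 2`). -/
def chart₂ : E3 ≃L[ℝ] E3 := mkChart chartLin' le_norm_chartLin'

/-- Helper `chartLin_t₁` (lens-2 g24 HomCoercivityBD v8 §5.1–§5.3; statement as displayed). [folklore] -/
theorem chartLin_t₁ : chartLin (triangularVec₁ 1) = kk • intVec ![1, 1, 0] := by
  ext i; fin_cases i <;> simp [chartLin_apply, triangularVec₁, intVec]

/-- Helper `chartLin_t₂` (lens-2 g24 HomCoercivityBD v8 §5.1–§5.3; statement as displayed). [folklore] -/
theorem chartLin_t₂ : chartLin (triangularVec₂ 1) = kk • intVec ![1, -1, 0] := by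
  have hs : Real.sqrt 3 * Real.sqrt 3 = 3 := Real.mul_self_sqrt (by norm_num)
  ext i; fin_cases i
  · simp [chartLin_apply, triangularVec₂, intVec, ss]
    linear_combination (kk / 6) * hs
  · simp [chartLin_apply, triangularVec₂, intVec, ss]
    linear_combination (-(kk / 2)) * hs
  · simp [chartLin_apply, triangularVec₂, intVec]

/-- the layer offsets of the reference structure of patch 1: layer `m` of `fcc` is the `(001)` plane `z = m/√2`. -/
def w₁ (m : ℤ) : E3 := kk • intVec ![m, 0, m]

set_option linter.unusedTactic false in
/-- **layer points in cubic coordinates.** -/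
theorem layerPoint (m i j : ℤ) :
    chartLin (((i : ℝ) • triangularVec₁ 1) + ((j : ℝ) • triangularVec₂ 1)) + w₁ m = kk • intVec ![i + j + m, i - j, m] := by
  rw [map_add, map_smul, map_smul, chartLin_t₁, chartLin_t₂, w₁]
  ext l; fin_cases l <;> simp [intVec] <;> push_cast <;> ring

/-- the reference structure of patch 1 IS `fcc`: `LayeredHom chart₁ w₁ ⊆ fcc` … -/
theorem layered₁_subset_fcc : LayeredHom (chart₁ : E3 →L[ℝ] E3) w₁ ⊆ fcc := by
  rintro _ ⟨m, i, j, rfl⟩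
  rw [show (chart₁ : E3 →L[ℝ] E3) (((i : ℝ) • triangularVec₁ 1) + ((j : ℝ) • triangularVec₂ 1)) =
    chartLin (((i : ℝ) • triangularVec₁ 1) + ((j : ℝ) • triangularVec₂ 1)) from rfl, layerPoint]
  refine ⟨![i + j + m, i - j, m], ?_, rfl⟩
  simp only [Matrix.cons_val_zero, Matrix.cons_val_one, Matrix.cons_val_two, Matrix.head_cons, Matrix.tail_cons]
  exact ⟨i + m, by ring⟩

/-- … and `fcc ⊆ LayeredHom chart₁ w₁`. -/
theorem fcc_subset_layered₁ : fcc ⊆ LayeredHom (chart₁ : E3 →L[ℝ] E3) w₁ := by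
  rintro _ ⟨v, ⟨t, ht⟩, rfl⟩
  refine ⟨v 2, t - v 2, v 0 - t, ?_⟩
  rw [show (chart₁ : E3 →L[ℝ] E3) ((((t - v 2 : ℤ) : ℝ) • triangularVec₁ 1) + (((v 0 - t : ℤ) : ℝ) • triangularVec₂ 1)) =
    chartLin ((((t - v 2 : ℤ) : ℝ) • triangularVec₁ 1) + (((v 0 - t : ℤ) : ℝ) • triangularVec₂ 1)) from rfl, layerPoint]
  have hv : v = ![t - v 2 + (v 0 - t) + v 2, t - v 2 - (v 0 - t), v 2] := by
    ext l; fin_cases l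
    all_goals simp
    all_goals omega
  rw [← hv]

end Summit.AtomisticToContinuum.Crystallization.Theorems.ChartedZeroExcessLayeredHomCoercivityBD

end
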